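import Mathlib.Analysis.InnerProductSpace.Adjoint
import Mathlib.Analysis.InnerProductSpace.LinearPMap
import Mathlib.Topology.Algebra.Star.Unitary
import Mathlib.RepresentationTheory.Continuous.Basic
import Mathlib.Analysis.Calculus.Deriv.Basic
import Mathlib.Analysis.Calculus.MeanValue
import Literature.Analysis.UnboundedOperators.SymmetricPMap
import Literature.Analysis.UnboundedOperators.StrongContRepresentation
import HarnessLib

-- provenance: harness21/H21/H21/Prelude/UnbddOp/UnitaryRep.lean @ e53cdd0 (interim HEAD d8f2665); M5 mechanical rewrite
/-!
# Strongly continuous unitary representations and the Stone generator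
(trunk G07 UnbddOp, item C4 `UnitaryRep`)

A *strongly continuous unitary representation* of a topological group `G` on a complex Hilbert
space `H` is a homomorphism `U : G →* 𝒰(H)` into the unitary group such that every orbit map
`g ↦ U g x` is continuous. We bundle it as a `StrongContRepresentation ℂ G H` (item C3) all of
whose values lie in `unitary (H →L[ℂ] H)`, and provide: the invariant vectors (vacuum vectors),
one-parameter unitary groups `U : ℝ → 𝒰(H)`, their *Hamiltonian* `H` with the physics convention
`U(t) = exp (i t H)`, i.e. `H = -i A` where `A` is the semigroup generator of C3, positivity of the
energy, and Stone's theorem (self-adjointness of `H`) as a `sorry`-ed theorem.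

Sources: M. H. Stone, *On one-parameter unitary groups in Hilbert space*, Ann. of Math. 33 (1932);
M. Reed, B. Simon, *Methods of Modern Mathematical Physics I* (1980), §VIII.4, Thms. VIII.7–VIII.8;
G. B. Folland, *A Course in Abstract Harmonic Analysis* (1995), §3.1;
R. F. Streater, A. S. Wightman, *PCT, Spin and Statistics, and All That* (1964), §3.1 (vacuum,
uniqueness of the vacuum, spectral condition).

## Mathlib

Mathlib (pinned) has `unitary (H →L[ℂ] H)`, `ContinuousLinearMap.norm_map_of_mem_unitary`,
`ContinuousLinearMap.inner_map_map_of_mem_unitary`, `ContinuousLinearMap.adjoint`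
(`= star`), `ContRepresentation.invariants` / `mem_invariants`, `LinearPMap.instSMul` and
`HasDerivAt`; it has no (strongly continuous) unitary representations, no Stone generator and no
Stone theorem. Everything below is a thin layer over these anchors and over C1
(`LinearPMap.IsPositive`, `LinearPMap.HasEigenvector`, `LinearPMap.kernel`) and C3
(`StrongContRepresentation`, `OneParameterGroup.generator`).

## Design choices

* `UnitaryRep G H extends StrongContRepresentation ℂ G H` with the single extra field
  `mem_unitary`; `[Group G] [TopologicalSpace G]` (no `IsTopologicalGroup` needed for the
  definitions), `H` a complex Hilbert space.
* `IsVacuum U Ω := Ω ∈ U.invariantVectors ∧ Ω ≠ 0` deliberately carries **no normalisation**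
  `‖Ω‖ = 1`: no target statement depends on it and this makes the constructive-QFT (S09) bridge an
  `↔`.
* `hamiltonian U := (-Complex.I) • OneParameterGroup.generator U.toStrongContRepresentation`,
  written with the explicit projection (dot notation from `UnitaryRep` does not reach the
  `OneParameterGroup` namespace). Convention: `U(t) = exp (t A) = exp (i t H)`, `H = -i A`.
* Not included: the converse direction of Stone's theorem (constructing `U` from a self-adjoint
  `H`), which needs the spectral theorem.
-/

noncomputable section

open Filter Topology ComplexConjugate
open scoped InnerProductSpace

namespace Literature.Analysis.UnboundedOperators

/-! ### Unitary representations -/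

/-- A *strongly continuous unitary representation* of a topological group `G` on a complex Hilbert
space `H`: a strongly continuous representation `U : G →* (H →L[ℂ] H)` with `U g` unitary for
every `g` (Folland (1995), §3.1; Reed–Simon I, §VIII.4). [cite: Folland1995] -/
structure UnitaryRep (G H : Type*) [Group G] [TopologicalSpace G] [NormedAddCommGroup H]
    [InnerProductSpace ℂ H] [CompleteSpace H] extends StrongContRepresentation ℂ G H where
  /-- Every operator `U g` is unitary. -/
  mem_unitary : ∀ g : G, toMonoidHom g ∈ unitary (H →L[ℂ] H)

namespace UnitaryRep

variable {G G' H : Type*} [Group G] [TopologicalSpace G] [Group G'] [TopologicalSpace G']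
  [NormedAddCommGroup H] [InnerProductSpace ℂ H] [CompleteSpace H]

/-- A unitary representation is a function `G → (H →L[ℂ] H)` (Folland (1995), §3.1). [cite: Folland1995] -/
instance instFunLike : FunLike (UnitaryRep G H) G (H →L[ℂ] H) where
  coe U := U.toStrongContRepresentation
  coe_injective U₁ U₂ h := by
    obtain ⟨π₁, _⟩ := U₁
    obtain ⟨π₂, _⟩ := U₂
    congr
    exact DFunLike.coe_injective h

/-- A unitary representation is a monoid homomorphism `G →* (H →L[ℂ] H)`
(Folland (1995), §3.1). [cite: Folland1995] -/
instance instMonoidHomClass : MonoidHomClass (UnitaryRep G H) G (H →L[ℂ] H) where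
  map_one U := U.toMonoidHom.map_one
  map_mul U := U.toMonoidHom.map_mul

/-- Two unitary representations agreeing pointwise are equal (Folland (1995), §3.1). [cite: Folland1995] -/
@[ext]
theorem ext {U₁ U₂ : UnitaryRep G H} (h : ∀ g, U₁ g = U₂ g) : U₁ = U₂ :=
  DFunLike.ext _ _ h

/-- The coercion of the underlying `StrongContRepresentation` agrees with the coercion of `U`
(Folland (1995), §3.1). [cite: Folland1995] -/
@[simp]
theorem coe_toStrongContRepresentation (U : UnitaryRep G H) :
    ⇑U.toStrongContRepresentation = ⇑U := rfl

/-- The underlying monoid homomorphism agrees with the coercion of `U` (Folland (1995), §3.1). [cite: Folland1995] -/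
@[simp]
theorem toMonoidHom_apply (U : UnitaryRep G H) (g : G) : U.toMonoidHom g = U g := rfl

/-- `U g` is a unitary operator (Folland (1995), §3.1). [cite: Folland1995] -/
theorem apply_mem_unitary (U : UnitaryRep G H) (g : G) : U g ∈ unitary (H →L[ℂ] H) :=
  U.mem_unitary g

/-- Strong continuity: every orbit map `g ↦ U g x` is continuous (Folland (1995), §3.1). [cite: Folland1995] -/
@[continuity, fun_prop]
theorem continuous_apply_apply (U : UnitaryRep G H) (x : H) : Continuous fun g : G => U g x :=
  U.strongly_continuous x

/-- A unitary representation as a group homomorphism into the unitary group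
`G →* unitary (H →L[ℂ] H)` (Folland (1995), §3.1). [cite: Folland1995] -/
def toUnitaryHom (U : UnitaryRep G H) : G →* unitary (H →L[ℂ] H) where
  toFun g := ⟨U g, U.mem_unitary g⟩
  map_one' := Subtype.ext (map_one U)
  map_mul' g h := Subtype.ext (map_mul U g h)

/-- `↑(U.toUnitaryHom g) = U g` (Folland (1995), §3.1). [cite: Folland1995] -/
@[simp]
theorem coe_toUnitaryHom_apply (U : UnitaryRep G H) (g : G) :
    (U.toUnitaryHom g : H →L[ℂ] H) = U g := rfl

/-- Restriction of a unitary representation along a continuous group homomorphism `φ : G' →ₜ* G`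
(Mathlib: `ContRepresentation.restrict`; Folland (1995), §3.1). [cite: Folland1995] -/
def restrict (U : UnitaryRep G H) (φ : G' →ₜ* G) : UnitaryRep G' H where
  toStrongContRepresentation := U.toStrongContRepresentation.restrict φ
  mem_unitary g := U.mem_unitary (φ g)

/-- `U.restrict φ g' = U (φ g')` (Mathlib: `ContRepresentation.restrict_apply`). [folklore] -/
@[simp]
theorem restrict_apply (U : UnitaryRep G H) (φ : G' →ₜ* G) (g' : G') :
    U.restrict φ g' = U (φ g') := rfl

/-- Unitary operators are isometries: `‖U g x‖ = ‖x‖`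
(Mathlib: `ContinuousLinearMap.norm_map_of_mem_unitary`; Reed–Simon I, §VIII.4). [folklore] -/
@[simp]
theorem norm_map (U : UnitaryRep G H) (g : G) (x : H) : ‖U g x‖ = ‖x‖ :=
  (U g).norm_map_of_mem_unitary (U.mem_unitary g) x

/-- Unitary operators preserve inner products: `⟪U g x, U g y⟫ = ⟪x, y⟫`
(Mathlib: `ContinuousLinearMap.inner_map_map_of_mem_unitary`; Reed–Simon I, §VIII.4). [folklore] -/
@[simp]
theorem inner_map_map (U : UnitaryRep G H) (g : G) (x y : H) : ⟪U g x, U g y⟫_ℂ = ⟪x, y⟫_ℂ :=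
  (U g).inner_map_map_of_mem_unitary (U.mem_unitary g) x y

/-- The adjoint of `U g` is `U g⁻¹` (Folland (1995), §3.1: `π(x⁻¹) = π(x)*`). [cite: Folland1995] -/
theorem adjoint_apply (U : UnitaryRep G H) (g : G) :
    ContinuousLinearMap.adjoint (U g) = U g⁻¹ :=
  calc ContinuousLinearMap.adjoint (U g) = star (U g) * (U g * U g⁻¹) := by
        rw [← map_mul, mul_inv_cancel, map_one, mul_one]; rfl
    _ = U g⁻¹ := by
        rw [← mul_assoc, Unitary.star_mul_self_of_mem (U.apply_mem_unitary g), one_mul]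

/-! ### Invariant vectors and vacua -/

/-- The closed subspace of `U`-invariant vectors `{x | ∀ g, U g x = x}`
(Mathlib: `ContRepresentation.invariants`; Streater–Wightman (1964), §3.1, translation-invariant
states). [cite: StreaterWightman1964] -/
def invariantVectors (U : UnitaryRep G H) : Submodule ℂ H := U.toContRepresentation.invariants

/-- `x` is invariant iff `U g x = x` for all `g` (Mathlib: `ContRepresentation.mem_invariants`). [folklore] -/
@[simp]
theorem mem_invariantVectors_iff (U : UnitaryRep G H) (x : H) :
    x ∈ U.invariantVectors ↔ ∀ g, U g x = x :=
  Iff.rfl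

/-- The invariant vectors form a closed subspace (an intersection of equalisers of continuous
maps; Folland (1995), §3.1). [cite: Folland1995] -/
theorem isClosed_invariantVectors (U : UnitaryRep G H) :
    IsClosed (U.invariantVectors : Set H) := by
  have : (U.invariantVectors : Set H) = ⋂ g, {x : H | U g x = x} := by
    ext x; simp
  rw [this]
  exact isClosed_iInter fun g => isClosed_eq (U g).continuous continuous_id

/-- `Ω` is a *vacuum vector* for `U`: a non-zero invariant vector. Deliberately **not** normalised
(`‖Ω‖ = 1` is not required): no statement depends on the normalisation, and omitting it makes the
bridge to the unbundled constructive-QFT vocabulary an `↔`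
(Streater–Wightman (1964), §3.1, axiom on the vacuum). [cite: StreaterWightman1964] -/
def IsVacuum (U : UnitaryRep G H) (Ω : H) : Prop := Ω ∈ U.invariantVectors ∧ Ω ≠ 0

/-- `Ω` is the *unique vacuum* of `U`: a vacuum vector spanning the invariant vectors,
`U.invariantVectors = ℂ ∙ Ω` (Streater–Wightman (1964), §3.1, uniqueness of the vacuum). [cite: StreaterWightman1964] -/
def HasUniqueVacuum (U : UnitaryRep G H) (Ω : H) : Prop :=
  U.IsVacuum Ω ∧ U.invariantVectors = ℂ ∙ Ω

end UnitaryRep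

/-! ### One-parameter unitary groups and the Hamiltonian -/

/-- A *strongly continuous one-parameter unitary group* `(U(t))_{t ∈ ℝ}` on a complex Hilbert
space, encoded as a unitary representation of `Multiplicative ℝ`
(Stone (1932); Reed–Simon I, §VIII.4). [cite: Stone1932] -/
abbrev OneParameterUnitaryGroup (H : Type*) [NormedAddCommGroup H] [InnerProductSpace ℂ H]
    [CompleteSpace H] := UnitaryRep (Multiplicative ℝ) H

namespace UnitaryRep

variable {H : Type*} [NormedAddCommGroup H] [InnerProductSpace ℂ H] [CompleteSpace H]

/-- The operator `U(t)` of a one-parameter unitary group at time `t : ℝ`; the curve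
`ℝ → (H →L[ℂ] H)` consumed by the unbundled constructive-QFT vocabulary
(Reed–Simon I, §VIII.4). [folklore] -/
def appReal (U : OneParameterUnitaryGroup H) (t : ℝ) : H →L[ℂ] H := U (Multiplicative.ofAdd t)

/-- `U.appReal t` is `OneParameterGroup.app` of the underlying one-parameter group
(Reed–Simon I, §VIII.4). [folklore] -/
@[simp]
theorem app_toStrongContRepresentation (U : OneParameterUnitaryGroup H) (t : ℝ) :
    OneParameterGroup.app U.toStrongContRepresentation t = U.appReal t := rfl

/-- `U(0) = 1` (Reed–Simon I, §VIII.4). [folklore] -/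
@[simp]
theorem appReal_zero (U : OneParameterUnitaryGroup H) : U.appReal 0 = 1 := by
  simp [appReal]

/-- The group law `U(s + t) = U(s) U(t)` (Reed–Simon I, §VIII.4). [folklore] -/
theorem appReal_add (U : OneParameterUnitaryGroup H) (s t : ℝ) :
    U.appReal (s + t) = U.appReal s * U.appReal t := by
  simp [appReal, ofAdd_add]

/-- Strong continuity: `t ↦ U(t) x` is continuous (Reed–Simon I, §VIII.4). [folklore] -/
@[continuity, fun_prop]
theorem continuous_appReal_apply (U : OneParameterUnitaryGroup H) (x : H) :
    Continuous fun t : ℝ => U.appReal t x :=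
  (U.strongly_continuous x).comp continuous_ofAdd

/-- Each `U(t)` is unitary (Reed–Simon I, §VIII.4). [folklore] -/
theorem appReal_mem_unitary (U : OneParameterUnitaryGroup H) (t : ℝ) :
    U.appReal t ∈ unitary (H →L[ℂ] H) :=
  U.mem_unitary _

/-- The *Hamiltonian* (Stone generator) of a one-parameter unitary group: the partially defined
operator `H := -i A`, where `A x = lim_{t → 0} t⁻¹ (U(t) x - x)` is the generator of the underlying
one-parameter group (item C3), so that `U(t) = exp (t A) = exp (i t H)` (physics sign convention).
Stone (1932); Reed–Simon I, Thm. VIII.7–VIII.8. Uses Mathlib's `LinearPMap.instSMul`. [cite: Stone1932] -/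
def hamiltonian (U : OneParameterUnitaryGroup H) : H →ₗ.[ℂ] H :=
  (-Complex.I) • OneParameterGroup.generator U.toStrongContRepresentation

/-- The domain of the Hamiltonian is the domain of the generator `A` of the underlying group
(Mathlib: `LinearPMap.smul_domain`; Reed–Simon I, Thm. VIII.7). [folklore] -/
@[simp]
theorem hamiltonian_domain (U : OneParameterUnitaryGroup H) :
    U.hamiltonian.domain = (OneParameterGroup.generator U.toStrongContRepresentation).domain :=
  rfl

/-- Unfolding lemma: `H x = -i • A x` on the common domain (Reed–Simon I, Thm. VIII.7). [folklore] -/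
theorem hamiltonian_apply (U : OneParameterUnitaryGroup H) (x : U.hamiltonian.domain) :
    U.hamiltonian x = (-Complex.I) • OneParameterGroup.generator U.toStrongContRepresentation x :=
  rfl

/-- `U` has *positive energy* if its Hamiltonian is a positive operator, `0 ≤ ⟪x, H x⟫` on its
domain (spectral condition in one dimension; Streater–Wightman (1964), §3.1;
Reed–Simon II, §X.3). [cite: StreaterWightman1964] -/
def HasPositiveEnergy (U : OneParameterUnitaryGroup H) : Prop := U.hamiltonian.IsPositive

/-- **Stone's theorem** (generator half): the Hamiltonian of a strongly continuous one-parameter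
unitary group is self-adjoint (Stone (1932); Reed–Simon I, Thm. VIII.8; von Neumann (1932)). [cite: Stone1932] -/
def isSelfAdjoint_hamiltonian : Prop :=
  ∀ (U : OneParameterUnitaryGroup H),
    IsSelfAdjoint U.hamiltonian

/-- If the orbit `t ↦ U(t) ψ` is differentiable at `0` with derivative `η`, then `ψ ∈ D(H)` and
`H ψ = -i η` (Reed–Simon I, Thm. VIII.7 (c)–(d)). Here `H` is viewed as a real normed space by
restriction of scalars. [cite: ReedSimonI1980, Thm VIII.7 (d)] -/
def hamiltonian_apply_of_hasDerivAt : Prop :=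
  ∀ (U : OneParameterUnitaryGroup H) {ψ η : H} (h : HasDerivAt (fun t : ℝ => U.appReal t ψ) η 0),
    ∃ hψ : ψ ∈ U.hamiltonian.domain, U.hamiltonian ⟨ψ, hψ⟩ = (-Complex.I) • η

/-- Invariant vectors lie in the kernel of the Hamiltonian: `U(t) Ω = Ω` for all `t` implies
`Ω ∈ D(H)` and `H Ω = 0` (Reed–Simon I, Thm. VIII.7; the difference quotient vanishes
identically). [folklore] -/
theorem invariantVectors_le_kernel_hamiltonian (U : OneParameterUnitaryGroup H) :
    U.invariantVectors ≤ U.hamiltonian.kernel := by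
  intro x hx
  rw [mem_invariantVectors_iff] at hx
  set T := OneParameterGroup.toC0Semigroup U.toStrongContRepresentation
  have hfix : ∀ t : ℝ, T.app t.toNNReal x = x := fun t =>
    hx (Multiplicative.ofAdd ((t.toNNReal : NNReal) : ℝ))
  have h0 : Tendsto (fun t : ℝ => ((t⁻¹ : ℝ) : ℂ) • (T.app t.toNNReal x - x))
      (𝓝[>] 0) (𝓝 0) := by
    simp [hfix]
  have hxd : x ∈ T.generator.domain := (C0Semigroup.mem_generator_domain_iff T x).mpr ⟨0, h0⟩
  have hval : T.generator ⟨x, hxd⟩ = 0 := C0Semigroup.generator_apply_eq_of_tendsto T ⟨x, hxd⟩ h0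
  refine LinearPMap.mem_kernel_iff.mpr ⟨hxd, ?_⟩
  rw [hamiltonian_apply, smul_eq_zero]
  exact Or.inr hval

/-- A non-zero vector is invariant under `U` iff it is an eigenvector of the Hamiltonian with
eigenvalue `0`; the reverse direction uses `d/dt U(t) Ω = i U(t) H Ω = 0`
(Reed–Simon I, Thm. VIII.7 (c); Streater–Wightman (1964), §3.1). [cite: StreaterWightman1964] -/
def mem_invariantVectors_iff_hasEigenvector_zero : Prop :=
  ∀ (U : OneParameterUnitaryGroup H) {Ω : H} (hΩ : Ω ≠ 0),
    Ω ∈ U.invariantVectors ↔ U.hamiltonian.HasEigenvector 0 Ω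

end UnitaryRep

/-! ### Discharge of `UnitaryRep.mem_invariantVectors_iff_hasEigenvector_zero`

The kernel of the Hamiltonian consists exactly of the invariant vectors. The inclusion
`invariantVectors ≤ ker H` is `invariantVectors_le_kernel_hamiltonian` above. Conversely, for
`Ω ∈ D(A)` with `A Ω = 0` the forward orbit `t ↦ U(t) Ω` (`t ≥ 0`) is continuous with right
derivative `U(t) A Ω = 0` at every `t ≥ 0` (Engel–Nagel (2000), Ch. II Lemma 1.3 (ii), here
`C0Semigroup.hasDerivWithinAt_Ici_app_of_mem`; Reed–Simon I, Thm. VIII.7 (c):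
`d/dt U(t)ψ = U(t) iAψ` for `ψ ∈ D(A)`), hence constant (Mathlib's
`constant_of_has_deriv_right_zero`), and `U(-t) Ω = U(-t) U(t) Ω = Ω` by the group law. This is
the one-parameter form of Streater–Wightman's remark that the vacuum, `U(a, 1)Ψ₀ = Ψ₀`
(eq. (3-1)), "has zero energy" (§1-4, eq. (1-54)). -/

namespace UnitaryRep

variable {H : Type*} [NormedAddCommGroup H] [InnerProductSpace ℂ H] [CompleteSpace H]

/-- If `Ω` lies in the domain of the generator `A` of a one-parameter unitary group and `A Ω = 0`,
then `U(t) Ω = Ω` for every `t ∈ ℝ`. For `t ≥ 0`: the orbit `t ↦ U(t) Ω` is continuous with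
right derivative `U(t) A Ω = 0` (Reed–Simon I, Thm. VIII.7 (c); Engel–Nagel (2000), Ch. II
Lemma 1.3 (ii)), hence constant (`constant_of_has_deriv_right_zero`); for `t < 0` use
`U(t) Ω = U(t) U(-t) Ω = U(0) Ω`. [cite: ReedSimonI1980, Thm VIII.7 (c)] -/
theorem appReal_apply_eq_self_of_generator_apply_eq_zero (U : OneParameterUnitaryGroup H) {Ω : H}
    (hΩ : Ω ∈ (OneParameterGroup.generator U.toStrongContRepresentation).domain)
    (hA : OneParameterGroup.generator U.toStrongContRepresentation ⟨Ω, hΩ⟩ = 0) (t : ℝ) :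
    U.appReal t Ω = Ω := by
  -- Step 1: `U(s) Ω = Ω` for `s ≥ 0`, through the forward semigroup `T` and the orbit `f`.
  have key : ∀ s : ℝ, 0 ≤ s → U.appReal s Ω = Ω := by
    intro s hs
    set T := OneParameterGroup.toC0Semigroup U.toStrongContRepresentation with hT
    set f : ℝ → H := fun r => T.app r.toNNReal Ω with hf
    have hcont : Continuous f := (T.continuous_app Ω).comp continuous_real_toNNReal
    have hgen : T.generator ⟨Ω, hΩ⟩ = 0 := hA
    have hderiv : ∀ r ∈ Set.Ico 0 s, HasDerivWithinAt f 0 (Set.Ici r) r := by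
      intro r hr
      have h := C0Semigroup.hasDerivWithinAt_Ici_app_of_mem T ⟨Ω, hΩ⟩ r.toNNReal
      rw [hgen, map_zero, Real.coe_toNNReal r hr.1] at h
      exact h
    have hconst :=
      constant_of_has_deriv_right_zero hcont.continuousOn hderiv s ⟨hs, le_rfl⟩
    have hf0 : f 0 = Ω := by
      simp [hf]
    have hfs : f s = U.appReal s Ω := by
      simp only [hf, hT, OneParameterGroup.toC0Semigroup_app, Real.coe_toNNReal s hs,
        app_toStrongContRepresentation]
    rw [← hfs, hconst, hf0]
  -- Step 2: negative times by the group law.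
  rcases le_or_gt 0 t with ht | ht
  · exact key t ht
  · have h1 : U.appReal (-t) Ω = Ω := key (-t) (neg_nonneg.mpr ht.le)
    calc U.appReal t Ω = U.appReal t (U.appReal (-t) Ω) := by rw [h1]
      _ = U.appReal (t + -t) Ω := by rw [appReal_add]; rfl
      _ = Ω := by rw [add_neg_cancel, appReal_zero]; rfl

/-- The kernel of the Hamiltonian is contained in the invariant vectors: `Ω ∈ D(H)` and `H Ω = 0`
imply `U(t) Ω = Ω` for all `t` (`H = -i A`, so `A Ω = 0`, and the orbit has vanishing derivative;
Reed–Simon I, Thm. VIII.7 (c)). Converse of `invariantVectors_le_kernel_hamiltonian`.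
[cite: ReedSimonI1980, Thm VIII.7 (c)] -/
theorem kernel_hamiltonian_le_invariantVectors (U : OneParameterUnitaryGroup H) :
    U.hamiltonian.kernel ≤ U.invariantVectors := by
  intro Ω hΩ
  obtain ⟨hdom, hval⟩ := LinearPMap.mem_kernel_iff.mp hΩ
  rw [hamiltonian_apply, smul_eq_zero] at hval
  have hA : OneParameterGroup.generator U.toStrongContRepresentation ⟨Ω, hdom⟩ = 0 :=
    hval.resolve_left (neg_ne_zero.mpr Complex.I_ne_zero)
  rw [mem_invariantVectors_iff]
  intro g
  exact U.appReal_apply_eq_self_of_generator_apply_eq_zero hdom hA (Multiplicative.toAdd g)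

/-- The invariant vectors are exactly the kernel of the Hamiltonian, `{Ω | ∀ t, U(t) Ω = Ω} =
ker H` (Reed–Simon I, Thm. VIII.7 (c); the space of zero-energy vectors, Streater–Wightman
(1964), §1-4 eq. (1-54) and §3-1 eq. (3-1)). [cite: ReedSimonI1980, Thm VIII.7 (c)] -/
theorem invariantVectors_eq_kernel_hamiltonian (U : OneParameterUnitaryGroup H) :
    U.invariantVectors = U.hamiltonian.kernel :=
  le_antisymm U.invariantVectors_le_kernel_hamiltonian U.kernel_hamiltonian_le_invariantVectors

/-- **Discharge** of the named fact `mem_invariantVectors_iff_hasEigenvector_zero`: a non-zero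
vector is invariant under a one-parameter unitary group iff it is an eigenvector of the
Hamiltonian with eigenvalue `0` (Streater–Wightman (1964), §3-1 eq. (3-1) with §1-4 eq. (1-54):
the invariant vacuum has zero energy; analytic content Reed–Simon I, Thm. VIII.7 (c)). Proof:
`invariantVectors_eq_kernel_hamiltonian`. [cite: StreaterWightman1964, §3-1 eq. (3-1)] -/
theorem mem_invariantVectors_iff_hasEigenvector_zero_holds :
    mem_invariantVectors_iff_hasEigenvector_zero (H := H) := by
  intro U Ω hΩ
  rw [invariantVectors_eq_kernel_hamiltonian]
  exact ⟨fun h => ⟨h, hΩ⟩, fun h => h.1⟩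

end UnitaryRep

end Literature.Analysis.UnboundedOperators
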